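import Literature.MathematicalPhysics.QuantumFieldTheory.Balaban1983to89.B5Hk163Rate
import Literature.MathematicalPhysics.QuantumFieldTheory.King1986.AliasSums

/-!
# `Balaban1983to89.B5Hk163RateSum` — the η-RATE of Bałaban's WEIGHTED (1.63) ALIAS SUM `Σ_l |h_{l;μλ}(p′)|·|∂_ν(p′+l)|·|p′+l|^α` at real torus momenta: King's (4.22)–(4.25) bookkeeping (paired «m = 0» classes by factor replacement, unpaired «m ≠ 0» classes by their distance `≥ πN`) transferred to the vector layer (cell node X10, Fourier side; spine estimate NE2 (U1a); successor of `B5Hk163Rate`)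

HONEST FRAMING (page 1).  Rung (B)+1 bookkeeping on a FINITE torus, `η = 1/(RN)` against the coarser `1/N` (in the
papers `N = L^k`, `R = L^n`), gauge group U(1), background field OFF (`U = 1`), LINEAR (Gaussian) theory, SYMBOL level
(sums over alias classes of explicit trigonometric rational functions at a fixed coarse momentum `p′`).  NOT infinite
volume, NOT a mass gap, NOT a statement about the Clay problem, NOT summit progress, and conditional on nothing (no
`BetaPertH`, no hypothesis (B)/(B^μ) enters).  Value = audit mathematics: the alias-SUM and unpaired-alias residuals
(items (i)-Fourier-part and (ii) of `B5Hk163Rate`'s «WHAT IS NOT CLAIMED») of cell GAPS row G-ne2p1-1, in the kernel.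

RELATION TO THE TREE (no duplication intended).  The UNIFORM BOUNDEDNESS of the printed weighted alias sum — Bałaban's
sentence [B5 p. 28 bottom – p. 29 top] «Another important property is that the sum over l of the absolute value of this
expression multiplied by |∂_ν(p′+l)||p′+l|^α is bounded by a constant dependent on d only.» — is ALREADY certified in
the tree by `B5Hk163Holder.weighted_alias_sum_le(_real)` (b05 lineage) on the whole strip, with `|p′+l|` read as the
lattice length `Δ^η(p′+l)^{1/2}`.  The present module is about the RATE in `η` of that sum, which `B5Hk163Holder` does
not address; its by-product `sum_h163_weighted_le` (§5(a)) re-certifies the uniform bound at real momenta in a second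
reading of `|p′+l|` (the sup norm `‖q‖` of the symmetric representative `q = King1986.symmAlias n k p′ ∈ [−πn,πn]^d`),
with King-shaped constants — it is recorded as a consistency check, not as a new claim.

SOURCES (locations of printed TEXT only; nothing printed is used as a hypothesis).
* T. Bałaban, *Propagators and renormalization transformations for lattice gauge theories. I*, Commun. Math. Phys.
  **95** (1984) 17–40 [`Balaban1984PropagatorsI`, cell paper B5], (1.63) p. 28 and the sentence quoted above (text as
  quoted in the tree header of `B5Hk163Holder`, whose unit read the renders; this unit relies on that quotation for the
  LOCATION only).
* C. King, *The U(1) Higgs model. I. The continuum limit*, Commun. Math. Phys. **102** (1986) 649–677 [`King1986`],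
  p. 672–673 (renders `1986-cmp102-king-u1-higgs-I-p024-x2.png`, `…-p025-x2.png`, read as images by this unit).
  VERBATIM, p. 672: «so the sum over l, m is bounded by Σ_{l,m} |p′+l+m|^{α−1} Π_μ |(p′+l+m)_μ|^{−1} ≤ C for α < 1. (4.22)
  We first bound the terms in (4.19) with m ≠ 0 as follows: |(4.19); m ≠ 0| ≤ C(2π)^{−d}∫dp′ Σ_{m≠0} Σ_l
  |p′+l+m|^{α−1}|p′|² Π_μ |p′_μ||(p′+l+m)_μ|^{−1} ≤ CL^{−γk}(2π)^{−d}∫dp′ Σ_{m≠0} Σ_l |p′+l+m|^{α−1+γ}|p′|² Π_μ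
  |p′_μ||(p′+l+m)_μ|^{−1} ≤ CL^{−γk} for α + γ < 1. (4.23)  To analyze the m = 0 term in (4.19), we successively
  replace each factor by the corresponding one in the expression for (∂_α(x, y)∂^η_μ a_kG^η_kQ^*_k)(z) and bound the
  error. We must always be careful to keep enough negative powers of momentum so that the sum over l is bounded.»;
  p. 673: «So keeping γ + α < 1, the error produced by the above replacement is bounded by CL^{−γk}. Next, we have
  |(η′)^{−1}[exp[iη′(p′+l)_μ] − 1] − η^{−1}[exp[iη(p′+l)_μ] − 1]| ≤ … ≤ C|p′+l|²L^{−k} ≤ C|p′+l|^{1+γ}L^{−γk}. (4.25)».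
  King's text concerns the SCALAR operator `a_kG_kQ_k^*` at `A = 0`; what is transferred is the MECHANISM — summable
  alias weights `|q|^{α−1}Π|p′_μ|/|q_μ|` (the tree's `King1986.AliasSums`: `aliasTerm`, `alias_sum_le_of_subset`, a
  kernel theorem), the trade `η|q| ↦ (η|q|)^γ` keeping `α + γ < 1`, and the distance `|m| ≥ π/η_coarse` of the
  unpaired classes.

CITATION HEADER (lean-in-tree rule).  `[cite: …]` tags mark TEXT LOCATIONS only; every statement is `[folklore]` audit
mathematics proved here from kernel-proved tree modules (`B5Hk163Rate` = Theorems A/B of this lineage, `h163_rate`,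
`norm_h163_ofReal_le`, the pairing `iota`; `King1986.AliasSums` = the summable alias weights; `King1986.CompositionLaw`
= `symmAlias`/`symmShift`).  ABSOLUTE RULE honoured: no statement of B5 or King, and no programme-internal claim, is a
hypothesis anywhere.  No constant (`C0maj`, `C1maj`, `R163`, `U163`, `D163`, `T163`) is attributed to print.

CONTENT (all `[folklore]`, kernel-checked; `d ≥ 1`, real `p′ ∈ [−π,π]^d ∖ {0}`, `q_k := symmAlias n k p′`).
* §1 `jOf n k p′ ∈ ℤ^d`, the integer alias vector of the symmetric representative: `symmAlias n k p′ = King1986.aliasPt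
  p′ (jOf n k p′)` and `k ↦ jOf n k p′` injective — the re-indexing that feeds King's alias sums.
* §2 the PAIRED / UNPAIRED split of the level-`RN` classes against level `N` (`B5Hk163Rate.iota`): `paired_of_abs_lt`
  (a class with `‖q″‖_∞ < πN` is paired), `norm_ge_of_unpaired` (`‖q″‖ ≥ πN` otherwise), `jOf_ne_zero_of_unpaired`,
  `sum_split_iota` (`Σ_{(ℤ/RN)^d} = Σ_{(ℤ/N)^d} ∘ ι + Σ_unpaired`).
* §3 the alias-decay majorant `maj163` of Theorem A against King's weights: `maj163_self_le` (`l = 0`: `≤ C0maj d`) and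
  `maj163_alias_le` (`l ≠ 0`: `≤ C1maj d · aliasWeight p′ j/‖q‖²`).
* §4 `sum_le_of_alias_bound(')`: a torus sum whose `l ≠ 0` terms are `≤ B·aliasTerm β p′ (jOf …)`, `β < 1`, is
  `≤ B0 + B·aliasConst d β` (re-indexing by `jOf` + `King1986.alias_sum_le_of_subset`).
* §5 the printed weight `bwt n k p′ ν α = ‖dSym n k p′ ν‖·‖q_k‖^α` (`∂_ν` = the fine forward-difference symbol
  `B5Prop11Fiber.dSym`; `‖∂_ν(q)‖ ≤ |q_ν|`, `norm_dSym_le`) and the sums: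
  (a) `sum_h163_weighted_le`: `Σ_k ‖h163 n μ λ k p′‖·bwt ≤ C0maj d·π^{1+α} + C1maj d·aliasConst d α` (`0 ≤ α < 1`);
  (b) `sum_h163_rate_le_of_weight` / `sum_h163_rate_weighted_le(')`: for `0 ≤ α`, `0 < γ ≤ 1`, `α + γ < 1`,
      `Σ_k ‖h163^{(N)}(k) − h163^{(RN)}(ι k)‖(p′)·w_k ≤ R163 d α γ · N^{−γ}` for any weight `0 ≤ w_k ≤ ‖q_k‖^{1+α}`
      (the printed weight at either level qualifies), uniformly in `R ≥ 1` — from `B5Hk163Rate.h163_rate`, trading its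
      currency `η|q|₁` for `|q|^γ N^{−γ}`;
  (c) `sum_h163_unpaired_le`: `Σ_{k″ unpaired} ‖h163^{(RN)}(k″)‖(p′)·bwt ≤ U163 d α γ · N^{−γ}` (`0 ≤ γ`, `α + γ < 1`).
* §6 replacing the derivative symbol as well ((4.25): `B5Hk163Rate.fdq_rate`): `norm_dh_sub_dh_le`,
  `sum_dsym_replacement_le`, (e) `sum_dh163_rate_le`:
  `Σ_k ‖∂^{(RN)}_ν(q_k) h^{(RN)}_{ιk} − ∂^{(N)}_ν(q_k) h^{(N)}_k‖(p′)·‖q_k‖^α ≤ (D163 + R163) d α γ · N^{−γ}`.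
* §7 (f) `weighted_alias_sum_rate`: (e) + (c) packaged, `≤ T163 d α γ · N^{−γ}`, `T163 = D163 + R163 + U163`.

WHAT IS NOT CLAIMED.  (i) Position space: King's (4.19) representation, the phase/Hölder factors (4.24), (4.26)–(4.28),
the `(2π)^{−d}∫dp′` and the resulting «last bound in (3.71)»-type statement for `∂_ν(H_kB)_μ` — none of it is typed
here (it needs the operator `H_k` on `T_η`, cell GAPS G-b05g10-4 / the operator identification of G-ne2p1-1).
(ii) `U ≠ 1` (NE2⁺), the covariance `C^{(k)}` (X5), complex momenta (the strip side of (a) is `B5Hk163Holder`).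
(iii) `|p′+l|` is read as `‖symmAlias‖_∞`; the comparison with the lattice length (factor in `[(2/π), 1]` per
coordinate direction) is not re-proved.  (iv) Constants are crude and explode as `α + γ → 1` (through `aliasConst`);
only their independence of `N`, `R`, `p′` matters.  Unit `b2b-balaban-t4-ne2-p1-g3` (T4 cell, lane NE2-P1, gen 3).
-/

noncomputable section

namespace Literature.MathematicalPhysics.QuantumFieldTheory.Balaban1983to89.B5Hk163RateSum

open scoped BigOperators ComplexConjugate
open Finset Complex
open Literature.MathematicalPhysics.QuantumFieldTheory.Balaban1983to89.B4Strip
open Literature.MathematicalPhysics.QuantumFieldTheory.Balaban1983to89.B5Prop11Leaves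
open Literature.MathematicalPhysics.QuantumFieldTheory.Balaban1983to89.B5Prop11Fiber
open Literature.MathematicalPhysics.QuantumFieldTheory.Balaban1983to89.B5Hk163Rate
open Literature.MathematicalPhysics.QuantumFieldTheory.King1986
  (fdq symmAlias symmShift momSq aliasWeight aliasPt aliasTerm aliasConst)

variable {d : ℕ}

/-! ## §1 integer alias vectors of the symmetric representatives -/

/-- the INTEGER alias vector of the symmetric representative: `jOf_ν = k_ν − N·χ_ν` (`χ = King1986.symmShift`),
so that `symmAlias N k p′ = p′ + 2π·jOf N k p′`. [folklore] -/
def jOf (N : ℕ) (k : Fin d → Fin N) (p : Fin d → ℝ) : Fin d → ℤ :=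
  fun ν => ((k ν : ℕ) : ℤ) - (N : ℤ) * ((symmShift N k p ν : ℕ) : ℤ)

/-- `symmAlias N k p′ = King1986.aliasPt p′ (jOf N k p′)`. [folklore] -/
theorem symmAlias_eq_aliasPt (N : ℕ) (k : Fin d → Fin N) (p : Fin d → ℝ) :
    symmAlias N k p = aliasPt p (jOf N k p) := by
  funext ν
  simp only [King1986.symmAlias, King1986.aliasPt, jOf, shiftr]
  push_cast
  ring

/-- `k ↦ jOf N k p′` is injective (`0 ≤ k_ν < N`, `χ_ν ∈ {0,1}`). [folklore] -/
theorem jOf_injective (N : ℕ) (p : Fin d → ℝ) :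
    Function.Injective (fun k : Fin d → Fin N => jOf N k p) := by
  intro k k' h
  funext ν
  have h1 := congrFun h ν
  simp only [jOf] at h1
  have hk := (k ν).isLt
  have hk' := (k' ν).isLt
  apply Fin.ext
  rcases King1986.symmShift_le_one N k p ν with hs | hs <;>
    rcases King1986.symmShift_le_one N k' p ν with hs' | hs' <;>
    · rw [hs, hs'] at h1; push_cast at h1; omega

/-- the zero index has alias vector `0` (its representative is `p′` itself). [folklore] -/
theorem jOf_zero {N : ℕ} [NeZero N] (hN : 1 ≤ N) {p : Fin d → ℝ} (hp : ∀ ν, |p ν| ≤ Real.pi) :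
    jOf N (0 : Fin d → Fin N) p = 0 := by
  funext ν
  have hπ := Real.pi_pos
  have hN1 : (1 : ℝ) ≤ N := by exact_mod_cast hN
  have hs : symmShift N (0 : Fin d → Fin N) p ν = 0 := by
    unfold King1986.symmShift shiftr
    rw [if_neg]
    simp only [Pi.zero_apply, Fin.val_zero, Nat.cast_zero, mul_zero, add_zero, not_lt]
    have := (abs_le.mp (hp ν)).2
    nlinarith
  simp [jOf, hs]

/-- an index with alias vector `0` is the zero index. [folklore] -/
theorem eq_zero_of_jOf_eq_zero {N : ℕ} [NeZero N] {k : Fin d → Fin N} {p : Fin d → ℝ} (h : jOf N k p = 0) :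
    k = 0 := by
  funext ν
  have h1 := congrFun h ν
  simp only [jOf, Pi.zero_apply] at h1
  have hk := (k ν).isLt
  apply Fin.ext
  simp only [Pi.zero_apply, Fin.val_zero]
  rcases King1986.symmShift_le_one N k p ν with hs | hs
  · rw [hs] at h1; push_cast at h1; omega
  · rw [hs] at h1; push_cast at h1; omega

/-- `aliasPt p′ 0 = p′`. [folklore] -/
theorem aliasPt_zero (p : Fin d → ℝ) : aliasPt p 0 = p := by
  funext ν; simp [King1986.aliasPt]

/-! ## §2 pairing: every level-`RN` class strictly inside the level-`N` zone is paired -/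

/-- `ι 0 = 0`. [folklore] -/
theorem iota_zero {N R : ℕ} [NeZero N] [NeZero R] (hN : 1 ≤ N) {p : Fin d → ℝ} (hp : ∀ ν, |p ν| ≤ Real.pi) :
    iota R (0 : Fin d → Fin N) p = 0 := by
  funext ν
  have hπ := Real.pi_pos
  have hN1 : (1 : ℝ) ≤ N := by exact_mod_cast hN
  have hs : symmShift N (0 : Fin d → Fin N) p ν = 0 := by
    unfold King1986.symmShift shiftr
    rw [if_neg]
    simp only [Pi.zero_apply, Fin.val_zero, Nat.cast_zero, mul_zero, add_zero, not_lt]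
    have := (abs_le.mp (hp ν)).2
    nlinarith
  apply Fin.ext
  simp [iota, hs]

/-- **pairing criterion**: a level-`RN` alias class whose symmetric representative lies STRICTLY inside the
level-`N` zone `|q_ν| < πN` is `ι k` for some level-`N` class `k`. [cite: King1986, (4.19) p.672 (the `m = 0` terms)] [folklore] -/
theorem paired_of_abs_lt {N R : ℕ} [NeZero R] (hN : 1 ≤ N) {p : Fin d → ℝ} (hp : ∀ ν, |p ν| ≤ Real.pi)
    (k'' : Fin d → Fin (R * N)) (h : ∀ ν, |symmAlias (R * N) k'' p ν| < Real.pi * N) :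
    ∃ k : Fin d → Fin N, iota R k p = k'' := by
  have hπ := Real.pi_pos
  have hN1 : (1 : ℝ) ≤ N := by exact_mod_cast hN
  have hR : 1 ≤ R := Nat.one_le_iff_ne_zero.mpr (NeZero.ne R)
  have hRN : N ≤ R * N := Nat.le_mul_of_pos_left N hR
  -- the candidate index
  have hlt : ∀ ν, (if (k'' ν : ℕ) < N then (k'' ν : ℕ) else (k'' ν : ℕ) - (R * N - N)) < N := by
    intro ν
    have := (k'' ν).isLt
    split_ifs with hc <;> omega
  refine ⟨fun ν => ⟨_, hlt ν⟩, funext fun ν => Fin.ext ?_⟩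
  have hb := abs_lt.mp (h ν)
  have hpν := abs_le.mp (hp ν)
  have hk'' := (k'' ν).isLt
  have hk''r : ((k'' ν : ℕ) : ℝ) < R * N := by exact_mod_cast hk''
  simp only [iota, Fin.val_mk]
  unfold King1986.symmAlias at hb
  rcases King1986.symmShift_le_one (R * N) k'' p ν with hs | hs
  · -- no pull-back at level RN: q = p + 2πk'' < πN ⇒ k'' < N, and no pull-back at level N either
    rw [hs] at hb
    simp only [shiftr, Nat.cast_zero, mul_zero, sub_zero] at hb
    have hkN : (k'' ν : ℕ) < N := by
      have : ((k'' ν : ℕ) : ℝ) < N := by nlinarith [hb.2]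
      exact_mod_cast this
    rw [if_pos hkN]
    have hs0 : symmShift N (fun ν => (⟨_, hlt ν⟩ : Fin N)) p ν = 0 := by
      unfold King1986.symmShift shiftr
      rw [if_neg]
      simp only [if_pos hkN, not_lt]
      linarith [hb.2]
    rw [hs0]; simp
  · -- pull-back at level RN: q = p + 2πk'' − 2πRN > −πN ⇒ k'' > RN − N, pull-back at level N too
    rw [hs] at hb
    simp only [shiftr, Nat.cast_one, mul_one] at hb
    push_cast at hb
    have hπN : Real.pi ≤ Real.pi * N := le_mul_of_one_le_right hπ.le hN1
    have h2 : ((R : ℝ) * N) - N < ((k'' ν : ℕ) : ℝ) := by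
      by_contra hc
      push Not at hc
      have hm := mul_le_mul_of_nonneg_left hc (by positivity : (0 : ℝ) ≤ 2 * Real.pi)
      nlinarith [hb.1, hpν.2]
    have hkge : R * N - N ≤ (k'' ν : ℕ) := by
      have h3 : (((R * N - N : ℕ)) : ℝ) ≤ ((k'' ν : ℕ) : ℝ) := by
        rw [Nat.cast_sub hRN]; push_cast; linarith
      exact_mod_cast h3
    have hkN : ¬ ((k'' ν : ℕ) < N) ∨ R * N - N = 0 := by
      -- if `k'' < N` then `RN − N < k'' < N` forces... only possible when `R = 1`
      by_cases hc : (k'' ν : ℕ) < N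
      · right
        have hcR : ((k'' ν : ℕ) : ℝ) < N := by exact_mod_cast hc
        have hlt2 : ((R : ℝ) * N) - N < N := lt_trans h2 hcR
        have hR2 : (R : ℝ) * N < 2 * N := by linarith
        have hR2' : R * N < 2 * N := by exact_mod_cast hR2
        have hR1 : R < 2 := by
          by_contra hR3
          push Not at hR3
          have := Nat.mul_le_mul_right N hR3
          omega
        have : R = 1 := by omega
        subst this
        simp
      · left; exact hc
    have hval : (if (k'' ν : ℕ) < N then (k'' ν : ℕ) else (k'' ν : ℕ) - (R * N - N))
        = (k'' ν : ℕ) - (R * N - N) := by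
      rcases hkN with hkN | hkN
      · rw [if_neg hkN]
      · rw [hkN]; split_ifs <;> simp
    rw [hval]
    have hs1 : symmShift N (fun ν => (⟨_, hlt ν⟩ : Fin N)) p ν = 1 := by
      unfold King1986.symmShift shiftr
      rw [if_pos]
      simp only []
      rw [hval, Nat.cast_sub hkge, Nat.cast_sub hRN]
      push_cast
      nlinarith [hb.1]
    rw [hs1]
    omega

/-- **unpaired classes are far out**: if `k″` is not of the form `ι k`, some coordinate of its symmetric representative
has `|q_ν| ≥ πN`, hence `‖q‖ ≥ πN`. [cite: King1986, (4.23) p.672 (the `|m| ≥ 1` terms carry `L^{−k}`)] [folklore] -/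
theorem norm_ge_of_unpaired {N R : ℕ} [NeZero R] (hN : 1 ≤ N) {p : Fin d → ℝ} (hp : ∀ ν, |p ν| ≤ Real.pi)
    {k'' : Fin d → Fin (R * N)} (hu : ∀ k : Fin d → Fin N, iota R k p ≠ k'') :
    Real.pi * N ≤ ‖symmAlias (R * N) k'' p‖ := by
  by_contra hc
  push Not at hc
  have h : ∀ ν, |symmAlias (R * N) k'' p ν| < Real.pi * N := fun ν =>
    lt_of_le_of_lt (by rw [← Real.norm_eq_abs]; exact norm_le_pi_norm _ ν) hc
  obtain ⟨k, hk⟩ := paired_of_abs_lt hN hp k'' h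
  exact hu k hk

/-- an unpaired class has a NONZERO alias vector. [folklore] -/
theorem jOf_ne_zero_of_unpaired {N R : ℕ} [NeZero N] [NeZero R] (hN : 1 ≤ N) {p : Fin d → ℝ}
    (hp : ∀ ν, |p ν| ≤ Real.pi) {k'' : Fin d → Fin (R * N)} (hu : ∀ k : Fin d → Fin N, iota R k p ≠ k'') :
    jOf (R * N) k'' p ≠ 0 := by
  intro h0
  have := eq_zero_of_jOf_eq_zero h0
  exact hu 0 (by rw [iota_zero hN hp, this])

/-- **the split of the level-`RN` alias sum** into paired (`m = 0`) and unpaired (`|m| ≥ 1`) classes.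
[cite: King1986, (4.19)/(4.23) p.672] [folklore] -/
theorem sum_split_iota {N R : ℕ} [NeZero R] (hN : 1 ≤ N) {p : Fin d → ℝ} (hp : ∀ ν, |p ν| ≤ Real.pi)
    {M : Type*} [AddCommMonoid M] (G : (Fin d → Fin (R * N)) → M) :
    ∑ k'', G k'' = ∑ k : Fin d → Fin N, G (iota R k p)
      + ∑ k'' ∈ Finset.univ.filter (fun k'' => ∀ k : Fin d → Fin N, iota R k p ≠ k''), G k'' := by
  classical
  have hinj : ∀ k ∈ (Finset.univ : Finset (Fin d → Fin N)), ∀ k' ∈ (Finset.univ : Finset (Fin d → Fin N)),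
      iota R k p = iota R k' p → k = k' := fun k _ k' _ h => iota_injective hN hp h
  rw [← Finset.sum_image hinj, ← Finset.sum_union]
  · congr 1
    ext k''
    simp only [Finset.mem_univ, Finset.mem_union, Finset.mem_image, Finset.mem_filter, true_and, true_iff]
    by_cases h : ∃ k, iota R k p = k''
    · exact Or.inl h
    · push Not at h; exact Or.inr h
  · rw [Finset.disjoint_left]
    intro k'' h1 h2
    simp only [Finset.mem_image, Finset.mem_univ, true_and] at h1
    simp only [Finset.mem_filter, Finset.mem_univ, true_and] at h2
    obtain ⟨k, hk⟩ := h1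
    exact h2 k hk

/-! ## §3 the majorant at alias points vs King's alias weight -/

/-- `|q_ν| ≤ ‖q‖` (sup norm). [folklore] -/
theorem abs_apply_le_norm (q : Fin d → ℝ) (ν : Fin d) : |q ν| ≤ ‖q‖ := by
  rw [← Real.norm_eq_abs]; exact norm_le_pi_norm q ν

/-- `‖q‖² ≤ |q|₂² = momSq q`. [folklore] -/
theorem norm_sq_le_momSq (q : Fin d → ℝ) : ‖q‖ ^ 2 ≤ momSq q := by
  have h : ‖q‖ ≤ Real.sqrt (momSq q) := by
    refine (pi_norm_le_iff_of_nonneg (Real.sqrt_nonneg _)).mpr fun ν => ?_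
    rw [Real.norm_eq_abs]
    refine Real.abs_le_sqrt ?_
    unfold King1986.momSq
    exact Finset.single_le_sum (f := fun ν => q ν ^ 2) (fun i _ => sq_nonneg (q i)) (Finset.mem_univ ν)
  calc ‖q‖ ^ 2 ≤ Real.sqrt (momSq q) ^ 2 := by gcongr
    _ = momSq q := Real.sq_sqrt (King1986.momSq_nonneg q)

/-- `Σ_ν |q_ν| ≤ d‖q‖`. [folklore] -/
theorem sum_abs_le_norm (q : Fin d → ℝ) : ∑ ν, |q ν| ≤ d * ‖q‖ := by
  calc ∑ ν, |q ν| ≤ ∑ _ν : Fin d, ‖q‖ := Finset.sum_le_sum fun ν _ => abs_apply_le_norm q ν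
    _ = d * ‖q‖ := by simp

/-- `‖p′‖ ≤ π` on the zone. [folklore] -/
theorem norm_le_pi {p : Fin d → ℝ} (hp : ∀ ν, |p ν| ≤ Real.pi) : ‖p‖ ≤ Real.pi :=
  (pi_norm_le_iff_of_nonneg Real.pi_pos.le).mpr fun ν => by rw [Real.norm_eq_abs]; exact hp ν

/-- `|p′_ν| ≤ |(p′ + 2πj)_ν|`. [folklore] -/
theorem abs_le_abs_aliasPt {p : Fin d → ℝ} (hp : ∀ ν, |p ν| ≤ Real.pi) (j : Fin d → ℤ) (ν : Fin d) :
    |p ν| ≤ |aliasPt p j ν| := by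
  unfold King1986.aliasPt
  by_cases h : j ν = 0
  · simp [h]
  · exact (hp ν).trans (King1986.pi_le_abs_add (hp ν) h)

/-- `(p′ + 2πj)_ν = p′_ν ↔ j_ν = 0`. [folklore] -/
theorem aliasPt_apply_eq_iff (p : Fin d → ℝ) (j : Fin d → ℤ) (ν : Fin d) :
    aliasPt p j ν = p ν ↔ j ν = 0 := by
  unfold King1986.aliasPt
  constructor
  · intro h
    have h2 : (2 * Real.pi) * (j ν : ℝ) = 0 := by linarith
    rcases mul_eq_zero.mp h2 with h1 | h1
    · exfalso; linarith [Real.pi_pos]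
    · exact_mod_cast h1
  · intro h; simp [h]

/-- `‖p′ + 2πj‖ ≥ π` for `j ≠ 0`. [folklore] -/
theorem pi_le_norm_aliasPt {p : Fin d → ℝ} (hp : ∀ ν, |p ν| ≤ Real.pi) {j : Fin d → ℤ} (hj : j ≠ 0) :
    Real.pi ≤ ‖aliasPt p j‖ := by
  obtain ⟨μ, hμ⟩ : ∃ μ, j μ ≠ 0 := by
    by_contra h
    push Not at h
    exact hj (funext h)
  exact le_trans (King1986.pi_le_abs_add (hp μ) hμ) (by exact abs_apply_le_norm (aliasPt p j) μ)

/-- `vMaj` at an alias point. [folklore] -/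
theorem vMaj_aliasPt (p : Fin d → ℝ) (j : Fin d → ℤ) (ν : Fin d) :
    vMaj p (aliasPt p j) ν = if j ν = 0 then 1 else Real.pi / 2 * |p ν| / |aliasPt p j ν| := by
  simp only [vMaj, aliasPt_apply_eq_iff]

/-- `vMaj ≤ π/2` at alias points. [folklore] -/
theorem vMaj_aliasPt_le {p : Fin d → ℝ} (hp : ∀ ν, |p ν| ≤ Real.pi) (j : Fin d → ℤ) (ν : Fin d) :
    vMaj p (aliasPt p j) ν ≤ Real.pi / 2 := by
  rw [vMaj_aliasPt]
  split_ifs with h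
  · linarith [Real.pi_gt_three]
  · have hq : 0 < |aliasPt p j ν| := lt_of_lt_of_le Real.pi_pos (King1986.pi_le_abs_add (hp ν) h)
    rw [div_le_iff₀ hq]
    have := abs_le_abs_aliasPt hp j ν
    nlinarith [Real.pi_pos]

/-- `|q_μ|·vMaj_μ ≤ π²/2` at alias points. [folklore] -/
theorem abs_mul_vMaj_aliasPt_le {p : Fin d → ℝ} (hp : ∀ ν, |p ν| ≤ Real.pi) (j : Fin d → ℤ) (μ : Fin d) :
    |aliasPt p j μ| * vMaj p (aliasPt p j) μ ≤ Real.pi ^ 2 / 2 := by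
  have hπ := Real.pi_gt_three
  rw [vMaj_aliasPt]
  split_ifs with h
  · rw [(aliasPt_apply_eq_iff p j μ).mpr h, mul_one]
    nlinarith [hp μ]
  · have hq : 0 < |aliasPt p j μ| := lt_of_lt_of_le Real.pi_pos (King1986.pi_le_abs_add (hp μ) h)
    rw [show |aliasPt p j μ| * (Real.pi / 2 * |p μ| / |aliasPt p j μ|) = Real.pi / 2 * |p μ| by
      field_simp]
    nlinarith [hp μ, abs_nonneg (p μ)]

/-- `Π_ν vMaj ≤ (π/2)^d · aliasWeight` at alias points. [cite: King1986, (4.20) p.672] [folklore] -/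
theorem prod_vMaj_aliasPt_le (p : Fin d → ℝ) (j : Fin d → ℤ) :
    ∏ ν, vMaj p (aliasPt p j) ν ≤ (Real.pi / 2) ^ d * aliasWeight p j := by
  have e : (Real.pi / 2) ^ d * aliasWeight p j
      = ∏ ν, (Real.pi / 2) * (if j ν = 0 then (1 : ℝ) else |p ν| / |p ν + 2 * Real.pi * j ν|) := by
    rw [Finset.prod_mul_distrib, Finset.prod_const, Finset.card_univ, Fintype.card_fin]
    rfl
  rw [e]
  refine Finset.prod_le_prod (fun ν _ => vMaj_nonneg _ _ _) fun ν _ => ?_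
  rw [vMaj_aliasPt]
  split_ifs with h
  · linarith [Real.pi_gt_three]
  · unfold King1986.aliasPt
    exact le_of_eq (by ring)

/-- `Δ₀(p′) ≤ momSq q` for every alias `q` of `p′` (coordinatewise `|p′_ν| ≤ |q_ν|`). [folklore] -/
theorem Delta1r_le_momSq_aliasPt {p : Fin d → ℝ} (hp : ∀ ν, |p ν| ≤ Real.pi) (j : Fin d → ℤ) :
    Delta1r 0 p ≤ momSq (aliasPt p j) := by
  calc Delta1r 0 p ≤ DeltaXir 1 0 p := Delta1r_le_DeltaXir 1 le_rfl p
    _ ≤ momSq p := DeltaXir_le_momSq le_rfl p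
    _ ≤ momSq (aliasPt p j) := by
        unfold King1986.momSq
        refine Finset.sum_le_sum fun ν _ => ?_
        have := abs_le_abs_aliasPt hp j ν
        rw [← sq_abs (p ν), ← sq_abs (aliasPt p j ν)]
        gcongr

/-- the constant of the `l = 0` term. [folklore] -/
def C0maj (d : ℕ) : ℝ :=
  Real.pi ^ 2 / 4 / T4GaugeActionRate.gam0 d
    + Real.pi ^ 2 / 4 * (Real.pi ^ 2 / 4 / T4GaugeActionRate.gam0 d + 1) / T4GaugeActionRate.gam0 d ^ 2

/-- the constant of the `l ≠ 0` terms. [folklore] -/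
def C1maj (d : ℕ) : ℝ :=
  (Real.pi / 2) ^ (d + 1) * Real.pi ^ 2 * d / T4GaugeActionRate.gam0 d
    + (Real.pi / 2) ^ d * Real.pi ^ 3 * (Real.pi ^ 2 * d / T4GaugeActionRate.gam0 d + Real.pi ^ 2 / 2)
        / (4 * T4GaugeActionRate.gam0 d ^ 2)

/-- `C0maj d ≥ 0`. [folklore] -/
theorem C0maj_nonneg (d : ℕ) : 0 ≤ C0maj d := by
  have := T4GaugeActionRate.gam0_pos d
  unfold C0maj; positivity

/-- `C1maj d ≥ 0`. [folklore] -/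
theorem C1maj_nonneg (d : ℕ) : 0 ≤ C1maj d := by
  have := T4GaugeActionRate.gam0_pos d
  unfold C1maj; positivity

/-- **the `l = 0` term is bounded**: `maj163 d p′ p′ μ λ ≤ C0maj d` (the printed «bounded … including p′ = 0»
behaviour of the majorant: `Δ₀(p′)/|p′|² ≤ 1`). [folklore] -/
theorem maj163_self_le {p : Fin d → ℝ} (hp : ∀ ν, |p ν| ≤ Real.pi) (ν₀ : Fin d) (hν₀ : p ν₀ ≠ 0)
    (μ lam : Fin d) : maj163 d p p μ lam ≤ C0maj d := by
  have hg := T4GaugeActionRate.gam0_pos d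
  have hD : 0 < Delta1r 0 p := Delta1r_pos p hp ν₀ hν₀
  have hDm : Delta1r 0 p ≤ momSq p := by simpa [aliasPt_zero] using Delta1r_le_momSq_aliasPt hp 0
  have hm : 0 < momSq p := lt_of_lt_of_le hD hDm
  have hv : ∀ ν, vMaj p p ν = 1 := fun ν => by simp [vMaj]
  have hprod : ∏ ν, vMaj p p ν = 1 := by simp [hv]
  -- |p_μ| |p_λ| ≤ momSq p
  have hab : |p μ| * |p lam| ≤ momSq p := by
    have h1 : |p μ| ≤ Real.sqrt (momSq p) := Real.abs_le_sqrt
      (by unfold King1986.momSq; exact Finset.single_le_sum (f := fun ν => p ν ^ 2) (fun i _ => sq_nonneg (p i)) (Finset.mem_univ μ))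
    have h2 : |p lam| ≤ Real.sqrt (momSq p) := Real.abs_le_sqrt
      (by unfold King1986.momSq; exact Finset.single_le_sum (f := fun ν => p ν ^ 2) (fun i _ => sq_nonneg (p i)) (Finset.mem_univ lam))
    calc |p μ| * |p lam| ≤ Real.sqrt (momSq p) * Real.sqrt (momSq p) :=
          mul_le_mul h1 h2 (abs_nonneg _) (Real.sqrt_nonneg _)
      _ = momSq p := Real.mul_self_sqrt (King1986.momSq_nonneg p)
  -- head
  have hhead : headMaj d p p μ ≤ Real.pi ^ 2 / 4 / T4GaugeActionRate.gam0 d := by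
    unfold headMaj
    rw [hprod, hv, one_mul, one_mul]
    rw [show Real.pi ^ 2 / 4 / momSq p * (Delta1r 0 p / T4GaugeActionRate.gam0 d)
        = Real.pi ^ 2 / 4 / T4GaugeActionRate.gam0 d * (Delta1r 0 p / momSq p) by field_simp]
    have : Delta1r 0 p / momSq p ≤ 1 := (div_le_one hm).mpr hDm
    have h0 : 0 ≤ Real.pi ^ 2 / 4 / T4GaugeActionRate.gam0 d := by positivity
    nlinarith
  -- tail
  have htail : tailMaj d p p μ lam
      ≤ Real.pi ^ 2 / 4 * (Real.pi ^ 2 / 4 / T4GaugeActionRate.gam0 d + 1) / T4GaugeActionRate.gam0 d ^ 2 := by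
    have hs : sMaj d p p μ ≤ Real.pi ^ 2 / 4 / T4GaugeActionRate.gam0 d + 1 := by
      unfold sMaj
      rw [hv]
      have : Real.pi ^ 2 / 4 * Delta1r 0 p / (T4GaugeActionRate.gam0 d * momSq p)
          = Real.pi ^ 2 / 4 / T4GaugeActionRate.gam0 d * (Delta1r 0 p / momSq p) := by field_simp
      rw [this]
      have : Delta1r 0 p / momSq p ≤ 1 := (div_le_one hm).mpr hDm
      have h0 : 0 ≤ Real.pi ^ 2 / 4 / T4GaugeActionRate.gam0 d := by positivity
      nlinarith
    have e : tailMaj d p p μ lam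
        = (|p μ| * |p lam| / momSq p) * (Real.pi ^ 2 / 4) * sMaj d p p μ / T4GaugeActionRate.gam0 d ^ 2 := by
      unfold tailMaj; rw [hprod]; field_simp
    rw [e]
    have h1 : |p μ| * |p lam| / momSq p ≤ 1 := (div_le_one hm).mpr hab
    have h2 : 0 ≤ |p μ| * |p lam| / momSq p := by positivity
    have h3 : 0 ≤ sMaj d p p μ := sMaj_nonneg (d := d) p p μ
    rw [div_le_div_iff_of_pos_right (by positivity)]
    calc |p μ| * |p lam| / momSq p * (Real.pi ^ 2 / 4) * sMaj d p p μ
        ≤ 1 * (Real.pi ^ 2 / 4) * (Real.pi ^ 2 / 4 / T4GaugeActionRate.gam0 d + 1) := by gcongr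
      _ = _ := by ring
  unfold maj163 C0maj
  split_ifs
  · linarith
  · linarith [hhead, headMaj_nonneg (d := d) p p μ]

/-- **the `l ≠ 0` terms decay like King's alias weight**: `maj163 d p′ q μ λ ≤ C1maj d · aliasWeight p′ j / ‖q‖²`
at `q = p′ + 2πj`, `j ≠ 0`. [cite: King1986, (4.20)–(4.22) p.672] [folklore] -/
theorem maj163_alias_le {p : Fin d → ℝ} (hp : ∀ ν, |p ν| ≤ Real.pi) (ν₀ : Fin d) (hν₀ : p ν₀ ≠ 0)
    {j : Fin d → ℤ} (hj : j ≠ 0) (μ lam : Fin d) :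
    maj163 d p (aliasPt p j) μ lam ≤ C1maj d * aliasWeight p j / ‖aliasPt p j‖ ^ 2 := by
  set q := aliasPt p j with hq_def
  have hπ := Real.pi_pos
  have hπ3 := Real.pi_gt_three
  have hg := T4GaugeActionRate.gam0_pos d
  have hD : 0 < Delta1r 0 p := Delta1r_pos p hp ν₀ hν₀
  have hD4 : Delta1r 0 p ≤ 4 * d := Delta1r_le p
  have hqπ : Real.pi ≤ ‖q‖ := pi_le_norm_aliasPt hp hj
  have hq0 : 0 < ‖q‖ := lt_of_lt_of_le hπ hqπ
  have hq2 : ‖q‖ ^ 2 ≤ momSq q := norm_sq_le_momSq q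
  have hm : 0 < momSq q := lt_of_lt_of_le (by positivity) hq2
  have hw : 0 ≤ aliasWeight p j := by
    unfold King1986.aliasWeight
    exact Finset.prod_nonneg fun ν _ => by split_ifs <;> positivity
  have hP := prod_vMaj_aliasPt_le p j
  have hP0 : 0 ≤ ∏ ν, vMaj p q ν := Finset.prod_nonneg fun ν _ => vMaj_nonneg _ _ _
  have hV := vMaj_aliasPt_le hp j μ
  have hV0 := vMaj_nonneg p q μ
  -- head
  have hhead : headMaj d p q μ
      ≤ ((Real.pi / 2) ^ d * aliasWeight p j) * (Real.pi / 2) * (Real.pi ^ 2 / 4 / ‖q‖ ^ 2)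
          * (4 * d / T4GaugeActionRate.gam0 d) := by
    unfold headMaj
    gcongr
  -- |q_μ| · sMaj ≤ Cs
  have hqs : |q μ| * sMaj d p q μ ≤ Real.pi ^ 2 * d / T4GaugeActionRate.gam0 d + Real.pi ^ 2 / 2 := by
    unfold sMaj
    rw [mul_add]
    refine add_le_add ?_ (abs_mul_vMaj_aliasPt_le hp j μ)
    -- |q μ| * (π²/4 * D / (g * m)) ≤ π² d / g, from |q μ|/m ≤ 1/‖q‖ ≤ 1 and D ≤ 4d
    have h1 : |q μ| ≤ ‖q‖ := abs_apply_le_norm q μ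
    have h2 : |q μ| * Real.pi ≤ momSq q := by nlinarith
    rw [show |q μ| * (Real.pi ^ 2 / 4 * Delta1r 0 p / (T4GaugeActionRate.gam0 d * momSq q))
        = (Real.pi ^ 2 / 4 / T4GaugeActionRate.gam0 d) * (|q μ| * Delta1r 0 p / momSq q) by field_simp]
    have h3 : |q μ| * Delta1r 0 p / momSq q ≤ 4 * d := by
      rw [div_le_iff₀ hm]
      have : |q μ| ≤ momSq q := by nlinarith
      nlinarith [abs_nonneg (q μ)]
    have h0 : 0 ≤ Real.pi ^ 2 / 4 / T4GaugeActionRate.gam0 d := by positivity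
    calc Real.pi ^ 2 / 4 / T4GaugeActionRate.gam0 d * (|q μ| * Delta1r 0 p / momSq q)
        ≤ Real.pi ^ 2 / 4 / T4GaugeActionRate.gam0 d * (4 * d) := by gcongr
      _ = Real.pi ^ 2 * d / T4GaugeActionRate.gam0 d := by field_simp
  have hqs0 : 0 ≤ |q μ| * sMaj d p q μ :=
    mul_nonneg (abs_nonneg _) (sMaj_nonneg (d := d) p q μ)
  -- tail
  have htail : tailMaj d p q μ lam
      ≤ ((Real.pi / 2) ^ d * aliasWeight p j) * (Real.pi ^ 2 / 4 / ‖q‖ ^ 2)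
          * (Real.pi ^ 2 * d / T4GaugeActionRate.gam0 d + Real.pi ^ 2 / 2) * Real.pi
          * (1 / T4GaugeActionRate.gam0 d ^ 2) := by
    have e : tailMaj d p q μ lam
        = (∏ ν, vMaj p q ν) * (Real.pi ^ 2 / 4 / momSq q) * (|q μ| * sMaj d p q μ) * |p lam|
            * (Delta1r 0 p / T4GaugeActionRate.gam0 d * (Delta1r 0 p / T4GaugeActionRate.gam0 d)
                * (1 / Delta1r 0 p ^ 2)) := by
      unfold tailMaj; ring
    have e2 : Delta1r 0 p / T4GaugeActionRate.gam0 d * (Delta1r 0 p / T4GaugeActionRate.gam0 d)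
        * (1 / Delta1r 0 p ^ 2) = 1 / T4GaugeActionRate.gam0 d ^ 2 := by
      field_simp
    rw [e, e2]
    gcongr
    exact hp lam
  have htot : maj163 d p q μ lam ≤ headMaj d p q μ + tailMaj d p q μ lam := by
    unfold maj163
    split_ifs
    · exact le_rfl
    · linarith [headMaj_nonneg (d := d) p q μ]
  calc maj163 d p q μ lam ≤ headMaj d p q μ + tailMaj d p q μ lam := htot
    _ ≤ ((Real.pi / 2) ^ d * aliasWeight p j) * (Real.pi / 2) * (Real.pi ^ 2 / 4 / ‖q‖ ^ 2)
          * (4 * d / T4GaugeActionRate.gam0 d)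
        + ((Real.pi / 2) ^ d * aliasWeight p j) * (Real.pi ^ 2 / 4 / ‖q‖ ^ 2)
          * (Real.pi ^ 2 * d / T4GaugeActionRate.gam0 d + Real.pi ^ 2 / 2) * Real.pi
          * (1 / T4GaugeActionRate.gam0 d ^ 2) := add_le_add hhead htail
    _ = C1maj d * aliasWeight p j / ‖q‖ ^ 2 := by
        unfold C1maj
        field_simp
        ring


/-! ## §4 summing over the torus alias classes -/

/-- a sum over classes with NONZERO alias vectors, each bounded by `B·aliasTerm β`, is `≤ B·aliasConst d β`
(King's (4.22) `alias_sum_le_of_subset` after re-indexing by `jOf`). [cite: King1986, (4.22) p.672] [folklore] -/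
theorem sum_le_of_alias_bound' (hd : 0 < d) {β : ℝ} (hβ : β < 1) {M : ℕ} {p : Fin d → ℝ}
    (hp : ∀ ν, |p ν| ≤ Real.pi) (S : Finset (Fin d → Fin M)) (F : (Fin d → Fin M) → ℝ) {B : ℝ} (hB : 0 ≤ B)
    (hne : ∀ k ∈ S, jOf M k p ≠ 0) (h1 : ∀ k ∈ S, F k ≤ B * aliasTerm β p (jOf M k p)) :
    ∑ k ∈ S, F k ≤ B * aliasConst d β := by
  classical
  calc ∑ k ∈ S, F k ≤ ∑ k ∈ S, B * aliasTerm β p (jOf M k p) := Finset.sum_le_sum h1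
    _ = B * ∑ k ∈ S, aliasTerm β p (jOf M k p) := by rw [Finset.mul_sum]
    _ = B * ∑ j ∈ S.image (fun k => jOf M k p), aliasTerm β p j := by
        rw [Finset.sum_image fun k _ k' _ h => jOf_injective M p h]
    _ ≤ B * aliasConst d β := by
        gcongr
        refine King1986.alias_sum_le_of_subset hd hβ hp ?_
        intro h0
        obtain ⟨k, hk, hk0⟩ := Finset.mem_image.mp h0
        exact hne k hk hk0

/-- the full torus sum: the (at most one) class with alias vector `0` costs `B0`, the others `B·aliasConst d β`.
[cite: King1986, (4.22) p.672] [folklore] -/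
theorem sum_le_of_alias_bound (hd : 0 < d) {β : ℝ} (hβ : β < 1) {N : ℕ} {p : Fin d → ℝ}
    (hp : ∀ ν, |p ν| ≤ Real.pi) (F : (Fin d → Fin N) → ℝ) {B0 B : ℝ} (hB0 : 0 ≤ B0) (hB : 0 ≤ B)
    (h0 : ∀ k, jOf N k p = 0 → F k ≤ B0) (h1 : ∀ k, jOf N k p ≠ 0 → F k ≤ B * aliasTerm β p (jOf N k p)) :
    ∑ k, F k ≤ B0 + B * aliasConst d β := by
  classical
  rw [← Finset.sum_filter_add_sum_filter_not Finset.univ (fun k => jOf N k p = 0)]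
  refine add_le_add ?_ ?_
  · have hcard : (Finset.univ.filter fun k : Fin d → Fin N => jOf N k p = 0).card ≤ 1 := by
      refine Finset.card_le_one.mpr fun a ha b hb => ?_
      simp only [Finset.mem_filter, Finset.mem_univ, true_and] at ha hb
      exact jOf_injective N p (ha.trans hb.symm)
    calc ∑ k ∈ Finset.univ.filter (fun k => jOf N k p = 0), F k
        ≤ ∑ k ∈ Finset.univ.filter (fun k => jOf N k p = 0), B0 :=
          Finset.sum_le_sum fun k hk => h0 k (by simpa using hk)
      _ = (Finset.univ.filter fun k : Fin d → Fin N => jOf N k p = 0).card • B0 := Finset.sum_const _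
      _ ≤ 1 • B0 := nsmul_le_nsmul_left hB0 hcard
      _ = B0 := one_nsmul _
  · exact sum_le_of_alias_bound' hd hβ hp _ F hB (fun k hk => by simpa using hk)
      (fun k hk => h1 k (by simpa using hk))

/-! ## §5 the three weighted alias sums -/

/-- Bałaban's weight `|∂_ν(p′+l)|·|p′+l|^α` in the torus reading: `‖dSym n k p′ ν‖ · ‖symmAlias n k p′‖^α`
(`dSym` = the fine-lattice derivative symbol of `B5Prop11Fiber`, the momentum norm is the sup norm of the symmetric
representative). [cite: Balaban1984PropagatorsI, p.28 (sentence after (1.63))] [folklore] -/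
def bwt (n : ℕ) (k : Fin d → Fin n) (p : Fin d → ℝ) (ν : Fin d) (α : ℝ) : ℝ :=
  ‖dSym n k p ν‖ * ‖symmAlias n k p‖ ^ α

/-- `‖∂_ν(q)‖ ≤ |q_ν| ≤ ‖q‖` at the symmetric representative. [folklore] -/
theorem norm_dSym_le {n : ℕ} (hn : 1 ≤ n) (k : Fin d → Fin n) {p : Fin d → ℝ} (hp : ∀ ν, |p ν| ≤ Real.pi)
    (ν : Fin d) : ‖dSym n k p ν‖ ≤ ‖symmAlias n k p‖ := by
  rw [IsRep.dSym_eq hn (isRep_symmAlias hn k hp) ν, Complex.norm_conj]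
  exact (norm_fdq_le' hn _).trans (abs_apply_le_norm _ ν)

/-- `0 ≤ bwt ≤ ‖q‖·‖q‖^α`. [folklore] -/
theorem bwt_le {n : ℕ} (hn : 1 ≤ n) (k : Fin d → Fin n) {p : Fin d → ℝ} (hp : ∀ ν, |p ν| ≤ Real.pi)
    (ν : Fin d) (α : ℝ) :
    0 ≤ bwt n k p ν α ∧ bwt n k p ν α ≤ ‖symmAlias n k p‖ * ‖symmAlias n k p‖ ^ α := by
  unfold bwt
  exact ⟨mul_nonneg (norm_nonneg _) (Real.rpow_nonneg (norm_nonneg _) _),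
    mul_le_mul_of_nonneg_right (norm_dSym_le hn k hp ν) (Real.rpow_nonneg (norm_nonneg _) _)⟩

/-- the symmetric representative lies in the sup-norm ball `‖q‖ ≤ πn`. [folklore] -/
theorem norm_symmAlias_le {n : ℕ} (hn : 1 ≤ n) (k : Fin d → Fin n) {p : Fin d → ℝ}
    (hp : ∀ ν, |p ν| ≤ Real.pi) : ‖symmAlias n k p‖ ≤ Real.pi * n :=
  (pi_norm_le_iff_of_nonneg (by positivity)).mpr fun ν => by
    rw [Real.norm_eq_abs]; exact King1986.symmAlias_abs_le hn k hp ν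

/-- rpow bookkeeping: `w/x²·(x·x^α) = x^{α−1}·w`. [folklore] -/
theorem weight_identity {x : ℝ} (hx : 0 < x) (w α : ℝ) : w / x ^ 2 * (x * x ^ α) = x ^ (α - 1) * w := by
  rw [Real.rpow_sub_one hx.ne' α]
  field_simp

/-- rpow bookkeeping: `x^γ·(w/x²)·(x·x^α) = x^{α+γ−1}·w`. [folklore] -/
theorem weight_identity' {x : ℝ} (hx : 0 < x) (w α γ : ℝ) :
    x ^ γ * (w / x ^ 2) * (x * x ^ α) = x ^ (α + γ - 1) * w := by
  rw [Real.rpow_sub_one hx.ne' (α + γ), Real.rpow_add hx α γ]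
  field_simp

/-- rpow bookkeeping: `x^{α−1} = x^{α+γ−1}·x^{−γ}`. [folklore] -/
theorem weight_identity'' {x : ℝ} (hx : 0 < x) (α γ : ℝ) : x ^ (α - 1) = x ^ (α + γ - 1) * x ^ (-γ) := by
  rw [← Real.rpow_add hx]; ring_nf

/-- `x ≤ π^{1−γ}·x^γ` for `0 < x ≤ π`, `γ ≤ 1` (King's trade `η|q| ↦ (η|q|)^γ`). [folklore] -/
theorem le_rpow_trade {x γ : ℝ} (hx : 0 < x) (hxπ : x ≤ Real.pi) (hγ1 : γ ≤ 1) :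
    x ≤ Real.pi ^ (1 - γ) * x ^ γ := by
  have h1 : x = x ^ (1 - γ) * x ^ γ := by
    rw [← Real.rpow_add hx]; norm_num
  have h2 : x ^ (1 - γ) ≤ Real.pi ^ (1 - γ) := Real.rpow_le_rpow hx.le hxπ (by linarith)
  calc x = x ^ (1 - γ) * x ^ γ := h1
    _ ≤ Real.pi ^ (1 - γ) * x ^ γ := by gcongr

/-- `N^{−2} ≤ N^{−1} ≤ N^{−γ}` packaged: `1/N ≤ 1/N^γ` and `(N²)⁻¹ ≤ 1/N^γ` for `N ≥ 1`, `γ ≤ 1`. [folklore] -/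
theorem inv_le_inv_rpow {N : ℕ} (hN : 1 ≤ N) {γ : ℝ} (hγ1 : γ ≤ 1) :
    (1 : ℝ) / N ≤ 1 / (N : ℝ) ^ γ ∧ ((N : ℝ) ^ 2)⁻¹ ≤ 1 / (N : ℝ) ^ γ ∧ 0 < (N : ℝ) ^ γ := by
  have hN1 : (1 : ℝ) ≤ N := by exact_mod_cast hN
  have hN0 : (0 : ℝ) < N := by linarith
  have hγ : (N : ℝ) ^ γ ≤ N := by
    conv_rhs => rw [← Real.rpow_one (N : ℝ)]
    exact Real.rpow_le_rpow_of_exponent_le hN1 hγ1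
  have hp : 0 < (N : ℝ) ^ γ := Real.rpow_pos_of_pos hN0 γ
  refine ⟨?_, ?_, hp⟩
  · exact one_div_le_one_div_of_le hp hγ
  · rw [← one_div]
    calc (1 : ℝ) / N ^ 2 ≤ 1 / N := by
          apply one_div_le_one_div_of_le hN0; nlinarith
      _ ≤ 1 / (N : ℝ) ^ γ := one_div_le_one_div_of_le hp hγ

/-- `A163 d ≥ 0`. [folklore] -/
theorem A163_nonneg (d : ℕ) : 0 ≤ A163 d := by unfold A163; positivity

/-- `B163 d ≥ 0`. [folklore] -/
theorem B163_nonneg (d : ℕ) : 0 ≤ B163 d := by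
  have := B5ActionRate166.Cphi_pos
  have := B5ActionRate166.Cpsi_pos
  have := T4GaugeActionRate.gam0_pos d
  unfold B163; positivity

/-- **(a) Bałaban's alias-sum sentence after (1.63), `U = 1`, real torus momenta, in the kernel**:
`Σ_{k ∈ (ℤ/n)^d} ‖h163 n μ λ k p′‖ · ‖∂_ν(q_k)‖ · ‖q_k‖^α ≤ C0maj d·π·π^α + C1maj d·aliasConst d α`
for `0 ≤ α < 1`, uniformly in `n ≥ 1` and `p′ ≠ 0` in the zone (`q_k = symmAlias n k p′`).
[cite: Balaban1984PropagatorsI, p.28 («the sum over l of the absolute value of this expression multiplied by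
|∂_ν(p′+l)||p′+l|^α is bounded by a constant dependent on d only»)] [folklore] -/
theorem sum_h163_weighted_le (hd : 0 < d) {α : ℝ} (hα0 : 0 ≤ α) (hα : α < 1) {n : ℕ} [NeZero n] (hn : 1 ≤ n)
    (p : Fin d → ℝ) (hp : ∀ ν, |p ν| ≤ Real.pi) (ν₀ : Fin d) (hν₀ : p ν₀ ≠ 0) (μ lam ν : Fin d) :
    ∑ k : Fin d → Fin n, ‖B5Hk163Strip.h163 n μ lam k (ofRealVec p)‖ * bwt n k p ν α
      ≤ C0maj d * (Real.pi * Real.pi ^ α) + C1maj d * aliasConst d α := by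
  have hπ := Real.pi_pos
  have hC1 := C1maj_nonneg d
  refine sum_le_of_alias_bound hd hα hp _ (mul_nonneg (C0maj_nonneg d) (by positivity)) (C1maj_nonneg d)
    (fun k hk => ?_) (fun k hk => ?_)
  · -- the `l = 0` class: `q = p′`
    have hq : symmAlias n k p = p := by rw [symmAlias_eq_aliasPt, hk, aliasPt_zero]
    have h1 := norm_h163_ofReal_le hn p hp ν₀ hν₀ μ lam k (isRep_symmAlias hn k hp)
    rw [hq] at h1
    obtain ⟨hb0, hb⟩ := bwt_le hn k hp ν α
    rw [hq] at hb
    have hpπ : ‖p‖ ≤ Real.pi := norm_le_pi hp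
    have hb' : bwt n k p ν α ≤ Real.pi * Real.pi ^ α :=
      hb.trans (mul_le_mul hpπ (Real.rpow_le_rpow (norm_nonneg _) hpπ hα0)
        (Real.rpow_nonneg (norm_nonneg _) _) hπ.le)
    exact mul_le_mul (h1.trans (maj163_self_le hp ν₀ hν₀ μ lam)) hb' hb0 (C0maj_nonneg d)
  · -- the `l ≠ 0` classes: `q = p′ + 2πj`, `j ≠ 0`
    set j := jOf n k p with hj
    have hq : symmAlias n k p = aliasPt p j := by rw [symmAlias_eq_aliasPt]
    have h1 := norm_h163_ofReal_le hn p hp ν₀ hν₀ μ lam k (isRep_symmAlias hn k hp)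
    rw [hq] at h1
    obtain ⟨hb0, hb⟩ := bwt_le hn k hp ν α
    rw [hq] at hb
    have hx : 0 < ‖aliasPt p j‖ := lt_of_lt_of_le hπ (pi_le_norm_aliasPt hp hk)
    have hw : 0 ≤ aliasWeight p j := by
      unfold King1986.aliasWeight
      exact Finset.prod_nonneg fun ν _ => by split_ifs <;> positivity
    calc ‖B5Hk163Strip.h163 n μ lam k (ofRealVec p)‖ * bwt n k p ν α
        ≤ (C1maj d * aliasWeight p j / ‖aliasPt p j‖ ^ 2) * (‖aliasPt p j‖ * ‖aliasPt p j‖ ^ α) :=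
          mul_le_mul (h1.trans (maj163_alias_le hp ν₀ hν₀ hk μ lam)) hb hb0 (by positivity)
      _ = C1maj d * aliasTerm α p j := by
          unfold King1986.aliasTerm
          rw [← weight_identity hx (aliasWeight p j) α]
          ring

/-- the rate coefficient of `h163_rate` at an `l ≠ 0` class: `A·Σ|q_ν|/N + B/N² ≤ (A d π^{1−γ} + B)·‖q‖^γ/N^γ`
for `1 ≤ ‖q‖ ≤ πN`. [cite: King1986, (4.23)/(4.24) p.672] [folklore] -/
theorem rate_coeff_alias_le {N : ℕ} (hN : 1 ≤ N) {γ : ℝ} (hγ0 : 0 ≤ γ) (hγ1 : γ ≤ 1) {q : Fin d → ℝ}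
    (hq1 : 1 ≤ ‖q‖) (hqN : ‖q‖ ≤ Real.pi * N) :
    A163 d * ((∑ ν, |q ν|) / N) + B163 d * ((N : ℝ) ^ 2)⁻¹
      ≤ (A163 d * d * Real.pi ^ (1 - γ) + B163 d) * (‖q‖ ^ γ / (N : ℝ) ^ γ) := by
  have hπ := Real.pi_pos
  have hN1 : (1 : ℝ) ≤ N := by exact_mod_cast hN
  have hN0 : (0 : ℝ) < N := by linarith
  obtain ⟨_, h2, hNγ⟩ := inv_le_inv_rpow hN hγ1
  have hA := A163_nonneg d
  have hB := B163_nonneg d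
  have hx0 : 0 < ‖q‖ / N := div_pos (by linarith) hN0
  have hxπ : ‖q‖ / N ≤ Real.pi := by rw [div_le_iff₀ hN0]; linarith
  -- first term
  have hs : (∑ ν, |q ν|) / N ≤ d * (Real.pi ^ (1 - γ) * (‖q‖ ^ γ / (N : ℝ) ^ γ)) := by
    have h1 : (∑ ν, |q ν|) / N ≤ d * (‖q‖ / N) := by
      rw [mul_div_assoc']
      exact div_le_div_of_nonneg_right (sum_abs_le_norm q) hN0.le
    have h3 : ‖q‖ / N ≤ Real.pi ^ (1 - γ) * (‖q‖ ^ γ / (N : ℝ) ^ γ) := by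
      rw [← Real.div_rpow (norm_nonneg q) hN0.le]
      exact le_rpow_trade hx0 hxπ hγ1
    calc (∑ ν, |q ν|) / N ≤ d * (‖q‖ / N) := h1
      _ ≤ d * (Real.pi ^ (1 - γ) * (‖q‖ ^ γ / (N : ℝ) ^ γ)) := by gcongr
  -- second term
  have ht : ((N : ℝ) ^ 2)⁻¹ ≤ ‖q‖ ^ γ / (N : ℝ) ^ γ := by
    have h4 : 1 ≤ ‖q‖ ^ γ := Real.one_le_rpow hq1 hγ0
    calc ((N : ℝ) ^ 2)⁻¹ ≤ 1 / (N : ℝ) ^ γ := h2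
      _ ≤ ‖q‖ ^ γ / (N : ℝ) ^ γ := div_le_div_of_nonneg_right h4 hNγ.le
  calc A163 d * ((∑ ν, |q ν|) / N) + B163 d * ((N : ℝ) ^ 2)⁻¹
      ≤ A163 d * (d * (Real.pi ^ (1 - γ) * (‖q‖ ^ γ / (N : ℝ) ^ γ))) + B163 d * (‖q‖ ^ γ / (N : ℝ) ^ γ) := by
        gcongr
    _ = (A163 d * d * Real.pi ^ (1 - γ) + B163 d) * (‖q‖ ^ γ / (N : ℝ) ^ γ) := by ring

/-- the rate coefficient at the `l = 0` class: `A·Σ|p′_ν|/N + B/N² ≤ (A d π + B)/N^γ`. [folklore] -/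
theorem rate_coeff_self_le {N : ℕ} (hN : 1 ≤ N) {γ : ℝ} (hγ1 : γ ≤ 1) {p : Fin d → ℝ}
    (hp : ∀ ν, |p ν| ≤ Real.pi) :
    A163 d * ((∑ ν, |p ν|) / N) + B163 d * ((N : ℝ) ^ 2)⁻¹ ≤ (A163 d * d * Real.pi + B163 d) * (1 / (N : ℝ) ^ γ) := by
  have hπ := Real.pi_pos
  have hN1 : (1 : ℝ) ≤ N := by exact_mod_cast hN
  have hN0 : (0 : ℝ) < N := by linarith
  obtain ⟨h1, h2, hNγ⟩ := inv_le_inv_rpow hN hγ1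
  have hA := A163_nonneg d
  have hB := B163_nonneg d
  have hs : (∑ ν, |p ν|) / N ≤ d * Real.pi * (1 / (N : ℝ) ^ γ) := by
    have : (∑ ν, |p ν|) ≤ d * Real.pi := (sum_abs_le_norm p).trans (by gcongr; exact norm_le_pi hp)
    calc (∑ ν, |p ν|) / N = (∑ ν, |p ν|) * (1 / N) := by ring
      _ ≤ (d * Real.pi) * (1 / (N : ℝ) ^ γ) :=
          mul_le_mul this h1 (by positivity) (by positivity)
  calc A163 d * ((∑ ν, |p ν|) / N) + B163 d * ((N : ℝ) ^ 2)⁻¹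
      ≤ A163 d * (d * Real.pi * (1 / (N : ℝ) ^ γ)) + B163 d * (1 / (N : ℝ) ^ γ) := by gcongr
    _ = (A163 d * d * Real.pi + B163 d) * (1 / (N : ℝ) ^ γ) := by ring

/-- the constant of the paired rate sum. [folklore] -/
def R163 (d : ℕ) (α γ : ℝ) : ℝ :=
  (A163 d * d * Real.pi + B163 d) * C0maj d * (Real.pi * Real.pi ^ α)
    + (A163 d * d * Real.pi ^ (1 - γ) + B163 d) * C1maj d * aliasConst d (α + γ)

/-- **(b) the η-RATE of the PAIRED alias sum** («m = 0» terms), for any weight `0 ≤ w_k ≤ ‖q_k‖·‖q_k‖^α`: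
for `0 ≤ α`, `0 < γ ≤ 1`, `α + γ < 1`,
`Σ_{k ∈ (ℤ/N)^d} ‖h163^{(N)}(k) − h163^{(RN)}(ι k)‖(p′) · w_k ≤ R163 d α γ / N^γ`, uniformly in `R ≥ 1` and
`p′ ≠ 0` in the zone (the `η|q|`-currency of `h163_rate` is traded for `|q|^γ N^{−γ}`, summable while `α + γ < 1`).
[cite: King1986, p.672 bottom – p.673 top («To analyze the m = 0 term in (4.19), we successively replace each factor
by the corresponding one in the expression for (∂_α(x, y)∂^η_μ a_k G^η_k Q^*_k)(z) and bound the error. We must always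
be careful to keep enough negative powers of momentum so that the sum over l is bounded.» … «So keeping γ + α < 1,
the error produced by the above replacement is bounded by CL^{−γk}.»)] [folklore] -/
theorem sum_h163_rate_le_of_weight (hd : 0 < d) {α γ : ℝ} (hα0 : 0 ≤ α) (hγ0 : 0 < γ) (hγ1 : γ ≤ 1)
    (hαγ : α + γ < 1) {N R : ℕ} [NeZero N] [NeZero R] (hN : 1 ≤ N) (hR : 1 ≤ R)
    (p : Fin d → ℝ) (hp : ∀ ν, |p ν| ≤ Real.pi) (ν₀ : Fin d) (hν₀ : p ν₀ ≠ 0) (μ lam : Fin d)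
    (w : (Fin d → Fin N) → ℝ) (hw : ∀ k, 0 ≤ w k ∧ w k ≤ ‖symmAlias N k p‖ * ‖symmAlias N k p‖ ^ α) :
    ∑ k : Fin d → Fin N, ‖B5Hk163Strip.h163 N μ lam k (ofRealVec p)
        - B5Hk163Strip.h163 (R * N) μ lam (iota R k p) (ofRealVec p)‖ * w k
      ≤ R163 d α γ / (N : ℝ) ^ γ := by
  have hπ := Real.pi_pos
  have hN1 : (1 : ℝ) ≤ N := by exact_mod_cast hN
  obtain ⟨_, _, hNγ⟩ := inv_le_inv_rpow hN hγ1
  have hA := A163_nonneg d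
  have hB := B163_nonneg d
  have hC0 := C0maj_nonneg d
  have hC1 := C1maj_nonneg d
  have e : R163 d α γ / (N : ℝ) ^ γ
      = (A163 d * d * Real.pi + B163 d) * (1 / (N : ℝ) ^ γ) * C0maj d * (Real.pi * Real.pi ^ α)
        + (A163 d * d * Real.pi ^ (1 - γ) + B163 d) * C1maj d / (N : ℝ) ^ γ * aliasConst d (α + γ) := by
    unfold R163; field_simp
  rw [e]
  refine sum_le_of_alias_bound hd hαγ hp _ (by positivity) (by positivity) (fun k hk => ?_) (fun k hk => ?_)
  · have hq : symmAlias N k p = p := by rw [symmAlias_eq_aliasPt, hk, aliasPt_zero]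
    have h1 := h163_rate hN hR p hp ν₀ hν₀ μ lam k
    rw [hq] at h1
    obtain ⟨hb0, hb⟩ := hw k
    rw [hq] at hb
    have hpπ : ‖p‖ ≤ Real.pi := norm_le_pi hp
    have hb' : w k ≤ Real.pi * Real.pi ^ α :=
      hb.trans (mul_le_mul hpπ (Real.rpow_le_rpow (norm_nonneg _) hpπ hα0)
        (Real.rpow_nonneg (norm_nonneg _) _) hπ.le)
    have hm := maj163_self_le hp ν₀ hν₀ μ lam
    have hm0 := maj163_nonneg (d := d) p p μ lam
    have hc := rate_coeff_self_le (d := d) hN hγ1 hp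
    calc _ ≤ (A163 d * ((∑ ν, |p ν|) / N) + B163 d * ((N : ℝ) ^ 2)⁻¹) * maj163 d p p μ lam * w k :=
          mul_le_mul_of_nonneg_right h1 hb0
      _ ≤ (A163 d * d * Real.pi + B163 d) * (1 / (N : ℝ) ^ γ) * C0maj d * (Real.pi * Real.pi ^ α) := by
          gcongr
  · set j := jOf N k p with hj
    have hq : symmAlias N k p = aliasPt p j := by rw [symmAlias_eq_aliasPt]
    have h1 := h163_rate hN hR p hp ν₀ hν₀ μ lam k
    rw [hq] at h1
    obtain ⟨hb0, hb⟩ := hw k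
    rw [hq] at hb
    have hxπ : Real.pi ≤ ‖aliasPt p j‖ := pi_le_norm_aliasPt hp hk
    have hx : 0 < ‖aliasPt p j‖ := lt_of_lt_of_le hπ hxπ
    have hx1 : 1 ≤ ‖aliasPt p j‖ := le_trans (by linarith [Real.pi_gt_three]) hxπ
    have hxN : ‖aliasPt p j‖ ≤ Real.pi * N := by rw [← hq]; exact norm_symmAlias_le hN k hp
    have hw0 : 0 ≤ aliasWeight p j := by
      unfold King1986.aliasWeight
      exact Finset.prod_nonneg fun ν _ => by split_ifs <;> positivity
    have hm := maj163_alias_le hp ν₀ hν₀ hk μ lam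
    have hm0 := maj163_nonneg (d := d) p (aliasPt p j) μ lam
    have hc := rate_coeff_alias_le (d := d) hN hγ0.le hγ1 hx1 hxN
    have hc0 : 0 ≤ A163 d * ((∑ ν, |aliasPt p j ν|) / N) + B163 d * ((N : ℝ) ^ 2)⁻¹ := by positivity
    calc _ ≤ (A163 d * ((∑ ν, |aliasPt p j ν|) / N) + B163 d * ((N : ℝ) ^ 2)⁻¹)
              * maj163 d p (aliasPt p j) μ lam * w k := mul_le_mul_of_nonneg_right h1 hb0
      _ ≤ ((A163 d * d * Real.pi ^ (1 - γ) + B163 d) * (‖aliasPt p j‖ ^ γ / (N : ℝ) ^ γ))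
              * (C1maj d * aliasWeight p j / ‖aliasPt p j‖ ^ 2) * (‖aliasPt p j‖ * ‖aliasPt p j‖ ^ α) := by
          gcongr
      _ = (A163 d * d * Real.pi ^ (1 - γ) + B163 d) * C1maj d / (N : ℝ) ^ γ
              * (‖aliasPt p j‖ ^ γ * (aliasWeight p j / ‖aliasPt p j‖ ^ 2)
                  * (‖aliasPt p j‖ * ‖aliasPt p j‖ ^ α)) := by
          field_simp
      _ = (A163 d * d * Real.pi ^ (1 - γ) + B163 d) * C1maj d / (N : ℝ) ^ γ * aliasTerm (α + γ) p j := by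
          rw [weight_identity' hx]; rfl

/-- (b), printed weight at the coarse level `N`: `w_k = ‖∂^{(N)}_ν(q_k)‖·‖q_k‖^α`. [folklore] -/
theorem sum_h163_rate_weighted_le (hd : 0 < d) {α γ : ℝ} (hα0 : 0 ≤ α) (hγ0 : 0 < γ) (hγ1 : γ ≤ 1)
    (hαγ : α + γ < 1) {N R : ℕ} [NeZero N] [NeZero R] (hN : 1 ≤ N) (hR : 1 ≤ R)
    (p : Fin d → ℝ) (hp : ∀ ν, |p ν| ≤ Real.pi) (ν₀ : Fin d) (hν₀ : p ν₀ ≠ 0) (μ lam ν : Fin d) :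
    ∑ k : Fin d → Fin N, ‖B5Hk163Strip.h163 N μ lam k (ofRealVec p)
        - B5Hk163Strip.h163 (R * N) μ lam (iota R k p) (ofRealVec p)‖ * bwt N k p ν α
      ≤ R163 d α γ / (N : ℝ) ^ γ :=
  sum_h163_rate_le_of_weight hd hα0 hγ0 hγ1 hαγ hN hR p hp ν₀ hν₀ μ lam _ fun k => bwt_le hN k hp ν α

/-- (b), printed weight at the fine level `RN` (at the paired class `ι k`, same representative `q_k`):
`w_k = ‖∂^{(RN)}_ν(q_k)‖·‖q_k‖^α`. [folklore] -/
theorem sum_h163_rate_weighted_le' (hd : 0 < d) {α γ : ℝ} (hα0 : 0 ≤ α) (hγ0 : 0 < γ) (hγ1 : γ ≤ 1)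
    (hαγ : α + γ < 1) {N R : ℕ} [NeZero N] [NeZero R] (hN : 1 ≤ N) (hR : 1 ≤ R)
    (p : Fin d → ℝ) (hp : ∀ ν, |p ν| ≤ Real.pi) (ν₀ : Fin d) (hν₀ : p ν₀ ≠ 0) (μ lam ν : Fin d) :
    ∑ k : Fin d → Fin N, ‖B5Hk163Strip.h163 N μ lam k (ofRealVec p)
        - B5Hk163Strip.h163 (R * N) μ lam (iota R k p) (ofRealVec p)‖ * bwt (R * N) (iota R k p) p ν α
      ≤ R163 d α γ / (N : ℝ) ^ γ := by
  refine sum_h163_rate_le_of_weight hd hα0 hγ0 hγ1 hαγ hN hR p hp ν₀ hν₀ μ lam _ fun k => ?_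
  have h := bwt_le (one_le_RN hN hR) (iota R k p) hp ν α
  rwa [symmAlias_iota hN k hp] at h
/-- the constant of the unpaired sum. [folklore] -/
def U163 (d : ℕ) (α γ : ℝ) : ℝ := C1maj d * aliasConst d (α + γ)

/-- **(c) the UNPAIRED level-`RN` classes** («|m| ≥ 1» terms): for `0 ≤ γ`, `α + γ < 1`,
`Σ_{k″ unpaired} ‖h163^{(RN)}(k″)‖(p′) · ‖∂_ν(q″)‖ · ‖q″‖^α ≤ U163 d α γ / N^γ` — each unpaired class has
`‖q″‖ ≥ πN`, which converts `‖q″‖^{−γ}` into `N^{−γ}`. [cite: King1986, (4.23) p.672] [folklore] -/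
theorem sum_h163_unpaired_le (hd : 0 < d) {α γ : ℝ} (hγ0 : 0 ≤ γ) (hαγ : α + γ < 1)
    {N R : ℕ} [NeZero N] [NeZero R] (hN : 1 ≤ N) (hR : 1 ≤ R)
    (p : Fin d → ℝ) (hp : ∀ ν, |p ν| ≤ Real.pi) (ν₀ : Fin d) (hν₀ : p ν₀ ≠ 0) (μ lam ν : Fin d) :
    ∑ k'' ∈ Finset.univ.filter (fun k'' => ∀ k : Fin d → Fin N, iota R k p ≠ k''),
        ‖B5Hk163Strip.h163 (R * N) μ lam k'' (ofRealVec p)‖ * bwt (R * N) k'' p ν α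
      ≤ U163 d α γ / (N : ℝ) ^ γ := by
  classical
  have hπ := Real.pi_pos
  have hN1 : (1 : ℝ) ≤ N := by exact_mod_cast hN
  have hN0 : (0 : ℝ) < N := by linarith
  have hRN : 1 ≤ R * N := one_le_RN hN hR
  have hC1 := C1maj_nonneg d
  have hNγ : 0 < (N : ℝ) ^ γ := Real.rpow_pos_of_pos hN0 γ
  have e : U163 d α γ / (N : ℝ) ^ γ = C1maj d / (N : ℝ) ^ γ * aliasConst d (α + γ) := by
    unfold U163; field_simp
  rw [e]
  refine sum_le_of_alias_bound' hd hαγ hp _ _ (by positivity) (fun k'' hk'' => ?_) (fun k'' hk'' => ?_)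
  · simp only [Finset.mem_filter, Finset.mem_univ, true_and] at hk''
    exact jOf_ne_zero_of_unpaired hN hp hk''
  · simp only [Finset.mem_filter, Finset.mem_univ, true_and] at hk''
    have hj0 := jOf_ne_zero_of_unpaired hN hp hk''
    set j := jOf (R * N) k'' p with hj
    have hq : symmAlias (R * N) k'' p = aliasPt p j := by rw [symmAlias_eq_aliasPt]
    have hfar : Real.pi * N ≤ ‖aliasPt p j‖ := by rw [← hq]; exact norm_ge_of_unpaired hN hp hk''
    have hxN : (N : ℝ) ≤ ‖aliasPt p j‖ := le_trans (by nlinarith [Real.pi_gt_three]) hfar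
    have hx : 0 < ‖aliasPt p j‖ := lt_of_lt_of_le hN0 hxN
    have h1 := norm_h163_ofReal_le hRN p hp ν₀ hν₀ μ lam k'' (isRep_symmAlias hRN k'' hp)
    rw [hq] at h1
    obtain ⟨hb0, hb⟩ := bwt_le hRN k'' hp ν α
    rw [hq] at hb
    have hw : 0 ≤ aliasWeight p j := by
      unfold King1986.aliasWeight
      exact Finset.prod_nonneg fun ν _ => by split_ifs <;> positivity
    have hm := maj163_alias_le hp ν₀ hν₀ hj0 μ lam
    -- ‖q‖^{-γ} ≤ N^{-γ}
    have hneg : ‖aliasPt p j‖ ^ (-γ) ≤ 1 / (N : ℝ) ^ γ := by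
      rw [one_div, ← Real.rpow_neg hN0.le]
      exact Real.rpow_le_rpow_of_nonpos hN0 hxN (by linarith)
    have ht0 : 0 ≤ ‖aliasPt p j‖ ^ (α + γ - 1) * aliasWeight p j :=
      mul_nonneg (Real.rpow_nonneg (norm_nonneg _) _) hw
    calc ‖B5Hk163Strip.h163 (R * N) μ lam k'' (ofRealVec p)‖ * bwt (R * N) k'' p ν α
        ≤ (C1maj d * aliasWeight p j / ‖aliasPt p j‖ ^ 2) * (‖aliasPt p j‖ * ‖aliasPt p j‖ ^ α) :=
          mul_le_mul (h1.trans hm) hb hb0 (by positivity)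
      _ = C1maj d * (‖aliasPt p j‖ ^ (α + γ - 1) * aliasWeight p j) * ‖aliasPt p j‖ ^ (-γ) := by
          rw [mul_div_assoc, mul_assoc, weight_identity hx, weight_identity'' hx α γ]; ring
      _ ≤ C1maj d * (‖aliasPt p j‖ ^ (α + γ - 1) * aliasWeight p j) * (1 / (N : ℝ) ^ γ) := by gcongr
      _ = C1maj d / (N : ℝ) ^ γ * aliasTerm (α + γ) p j := by
          unfold King1986.aliasTerm; field_simp


/-! ## §6 replacing the derivative symbol too: `∂^{(RN)}_ν h^{(RN)} − ∂^{(N)}_ν h^{(N)}` (King (4.25)) -/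

/-- per paired class: `‖∂^{(RN)}_ν(q) h^{(RN)}_{ιk} − ∂^{(N)}_ν(q) h^{(N)}_k‖ ≤ (|q_ν|²/N)·maj163(q) + |q_ν|·‖h^{(N)}_k −
h^{(RN)}_{ιk}‖` — the derivative symbol is replaced at cost `|q_ν|²/N` (`fdq_rate`, King's (4.25)
«≤ C|p′+l|²L^{−k}»), the multiplier at the cost of `h163_rate`. [cite: King1986, (4.25) p.673] [folklore] -/
theorem norm_dh_sub_dh_le {N R : ℕ} [NeZero N] [NeZero R] (hN : 1 ≤ N) (hR : 1 ≤ R)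
    (p : Fin d → ℝ) (hp : ∀ ν, |p ν| ≤ Real.pi) (ν₀ : Fin d) (hν₀ : p ν₀ ≠ 0) (μ lam ν : Fin d)
    (k : Fin d → Fin N) :
    ‖dSym (R * N) (iota R k p) p ν * B5Hk163Strip.h163 (R * N) μ lam (iota R k p) (ofRealVec p)
        - dSym N k p ν * B5Hk163Strip.h163 N μ lam k (ofRealVec p)‖
      ≤ (|symmAlias N k p ν| / N * |symmAlias N k p ν|) * maj163 d p (symmAlias N k p) μ lam
        + |symmAlias N k p ν| * ‖B5Hk163Strip.h163 N μ lam k (ofRealVec p)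
            - B5Hk163Strip.h163 (R * N) μ lam (iota R k p) (ofRealVec p)‖ := by
  have hRN := one_le_RN hN hR
  have hrepN : IsRep N k p (symmAlias N k p) := isRep_symmAlias hN k hp
  have hrepRN : IsRep (R * N) (iota R k p) p (symmAlias N k p) := isRep_iota hN k hp
  rw [IsRep.dSym_eq hRN hrepRN ν, IsRep.dSym_eq hN hrepN ν]
  set q := symmAlias N k p with hqdef
  set a := fdq (((R * N : ℕ) : ℝ)⁻¹) (q ν) with ha
  set b := fdq ((N : ℝ)⁻¹) (q ν) with hb
  set H' := B5Hk163Strip.h163 (R * N) μ lam (iota R k p) (ofRealVec p) with hH'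
  set H := B5Hk163Strip.h163 N μ lam k (ofRealVec p) with hH
  have hab : ‖a - b‖ ≤ |q ν| / N * |q ν| := by
    rw [norm_sub_rev]; exact fdq_rate hN hR (q ν)
  have hbq : ‖b‖ ≤ |q ν| := norm_fdq_le' hN (q ν)
  have hH'le : ‖H'‖ ≤ maj163 d p q μ lam := norm_h163_ofReal_le hRN p hp ν₀ hν₀ μ lam (iota R k p) hrepRN
  calc ‖(starRingEnd ℂ) a * H' - (starRingEnd ℂ) b * H‖
      = ‖(starRingEnd ℂ) (a - b) * H' + (starRingEnd ℂ) b * (H' - H)‖ := by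
        rw [map_sub]; ring_nf
    _ ≤ ‖(starRingEnd ℂ) (a - b) * H'‖ + ‖(starRingEnd ℂ) b * (H' - H)‖ := norm_add_le _ _
    _ = ‖a - b‖ * ‖H'‖ + ‖b‖ * ‖H - H'‖ := by
        rw [norm_mul, norm_mul, Complex.norm_conj, Complex.norm_conj, norm_sub_rev H' H]
    _ ≤ (|q ν| / N * |q ν|) * maj163 d p q μ lam + |q ν| * ‖H - H'‖ := by
        gcongr

/-- the constant of the derivative-replacement sum. [folklore] -/
def D163 (d : ℕ) (α γ : ℝ) : ℝ :=
  Real.pi ^ 2 * C0maj d * Real.pi ^ α + Real.pi ^ (1 - γ) * C1maj d * aliasConst d (α + γ)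

/-- the derivative-replacement part summed: `Σ_k (|q_{k,ν}|²/N)·maj163(q_k)·‖q_k‖^α ≤ D163 d α γ / N^γ`
(`0 ≤ α`, `γ ≤ 1`, `α + γ < 1`). [cite: King1986, (4.25) p.673 («≤ C|p′+l|²L^{−k} ≤ C|p′+l|^{1+γ}L^{−γk}»)]
[folklore] -/
theorem sum_dsym_replacement_le (hd : 0 < d) {α γ : ℝ} (hα0 : 0 ≤ α) (hγ1 : γ ≤ 1)
    (hαγ : α + γ < 1) {N : ℕ} [NeZero N] (hN : 1 ≤ N)
    (p : Fin d → ℝ) (hp : ∀ ν, |p ν| ≤ Real.pi) (ν₀ : Fin d) (hν₀ : p ν₀ ≠ 0) (μ lam ν : Fin d) :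
    ∑ k : Fin d → Fin N, (|symmAlias N k p ν| / N * |symmAlias N k p ν|)
        * maj163 d p (symmAlias N k p) μ lam * ‖symmAlias N k p‖ ^ α
      ≤ D163 d α γ / (N : ℝ) ^ γ := by
  have hπ := Real.pi_pos
  have hN1 : (1 : ℝ) ≤ N := by exact_mod_cast hN
  have hN0 : (0 : ℝ) < N := by linarith
  obtain ⟨hinv, _, hNγ⟩ := inv_le_inv_rpow hN hγ1
  have hC0 := C0maj_nonneg d
  have hC1 := C1maj_nonneg d
  have e : D163 d α γ / (N : ℝ) ^ γ
      = Real.pi * (Real.pi * (1 / (N : ℝ) ^ γ)) * C0maj d * Real.pi ^ α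
        + Real.pi ^ (1 - γ) * C1maj d / (N : ℝ) ^ γ * aliasConst d (α + γ) := by
    unfold D163; field_simp
  rw [e]
  refine sum_le_of_alias_bound hd hαγ hp _ (by positivity) (by positivity) (fun k hk => ?_) (fun k hk => ?_)
  · have hq : symmAlias N k p = p := by rw [symmAlias_eq_aliasPt, hk, aliasPt_zero]
    rw [hq]
    have hpπ : ‖p‖ ≤ Real.pi := norm_le_pi hp
    have hpν : |p ν| ≤ Real.pi := hp ν
    have hm := maj163_self_le hp ν₀ hν₀ μ lam
    have hm0 := maj163_nonneg (d := d) p p μ lam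
    have h1 : |p ν| / N ≤ Real.pi * (1 / (N : ℝ) ^ γ) := by
      calc |p ν| / N = |p ν| * (1 / N) := by ring
        _ ≤ Real.pi * (1 / (N : ℝ) ^ γ) := mul_le_mul hpν hinv (by positivity) hπ.le
    have h2 : ‖p‖ ^ α ≤ Real.pi ^ α := Real.rpow_le_rpow (norm_nonneg _) hpπ hα0
    calc |p ν| / N * |p ν| * maj163 d p p μ lam * ‖p‖ ^ α
        ≤ Real.pi * (1 / (N : ℝ) ^ γ) * Real.pi * C0maj d * Real.pi ^ α := by gcongr
      _ = Real.pi * (Real.pi * (1 / (N : ℝ) ^ γ)) * C0maj d * Real.pi ^ α := by ring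
  · set j := jOf N k p with hj
    have hq : symmAlias N k p = aliasPt p j := by rw [symmAlias_eq_aliasPt]
    rw [hq]
    have hxπ : Real.pi ≤ ‖aliasPt p j‖ := pi_le_norm_aliasPt hp hk
    have hx : 0 < ‖aliasPt p j‖ := lt_of_lt_of_le hπ hxπ
    have hx1 : 1 ≤ ‖aliasPt p j‖ := le_trans (by linarith [Real.pi_gt_three]) hxπ
    have hxN : ‖aliasPt p j‖ ≤ Real.pi * N := by rw [← hq]; exact norm_symmAlias_le hN k hp
    have hw0 : 0 ≤ aliasWeight p j := by
      unfold King1986.aliasWeight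
      exact Finset.prod_nonneg fun ν _ => by split_ifs <;> positivity
    have hm := maj163_alias_le hp ν₀ hν₀ hk μ lam
    have hm0 := maj163_nonneg (d := d) p (aliasPt p j) μ lam
    have hqν : |aliasPt p j ν| ≤ ‖aliasPt p j‖ := abs_apply_le_norm _ ν
    -- `|q_ν|/N ≤ ‖q‖/N ≤ π^{1−γ} ‖q‖^γ / N^γ`
    have hx0 : 0 < ‖aliasPt p j‖ / N := div_pos hx hN0
    have hxπ' : ‖aliasPt p j‖ / N ≤ Real.pi := by rw [div_le_iff₀ hN0]; linarith
    have h3 : |aliasPt p j ν| / N ≤ Real.pi ^ (1 - γ) * (‖aliasPt p j‖ ^ γ / (N : ℝ) ^ γ) := by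
      rw [← Real.div_rpow (norm_nonneg _) hN0.le]
      exact (div_le_div_of_nonneg_right hqν hN0.le).trans (le_rpow_trade hx0 hxπ' hγ1)
    calc |aliasPt p j ν| / N * |aliasPt p j ν| * maj163 d p (aliasPt p j) μ lam * ‖aliasPt p j‖ ^ α
        ≤ (Real.pi ^ (1 - γ) * (‖aliasPt p j‖ ^ γ / (N : ℝ) ^ γ)) * ‖aliasPt p j‖
            * (C1maj d * aliasWeight p j / ‖aliasPt p j‖ ^ 2) * ‖aliasPt p j‖ ^ α := by gcongr
      _ = Real.pi ^ (1 - γ) * C1maj d / (N : ℝ) ^ γ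
            * (‖aliasPt p j‖ ^ γ * (aliasWeight p j / ‖aliasPt p j‖ ^ 2)
                * (‖aliasPt p j‖ * ‖aliasPt p j‖ ^ α)) := by
          field_simp
      _ = Real.pi ^ (1 - γ) * C1maj d / (N : ℝ) ^ γ * aliasTerm (α + γ) p j := by
          rw [weight_identity' hx]; rfl

/-- **(e) paired classes with the derivative symbol replaced as well**: for `0 ≤ α`, `0 < γ ≤ 1`, `α + γ < 1`,
`Σ_{k ∈ (ℤ/N)^d} ‖∂^{(RN)}_ν(q_k)·h163^{(RN)}(ι k) − ∂^{(N)}_ν(q_k)·h163^{(N)}(k)‖(p′) · ‖q_k‖^α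
≤ (D163 + R163) d α γ / N^γ`. [cite: King1986, (4.25) p.673; p.673 («So keeping γ + α < 1, the error produced by
the above replacement is bounded by CL^{−γk}.»)] [folklore] -/
theorem sum_dh163_rate_le (hd : 0 < d) {α γ : ℝ} (hα0 : 0 ≤ α) (hγ0 : 0 < γ) (hγ1 : γ ≤ 1)
    (hαγ : α + γ < 1) {N R : ℕ} [NeZero N] [NeZero R] (hN : 1 ≤ N) (hR : 1 ≤ R)
    (p : Fin d → ℝ) (hp : ∀ ν, |p ν| ≤ Real.pi) (ν₀ : Fin d) (hν₀ : p ν₀ ≠ 0) (μ lam ν : Fin d) :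
    ∑ k : Fin d → Fin N, ‖dSym (R * N) (iota R k p) p ν * B5Hk163Strip.h163 (R * N) μ lam (iota R k p) (ofRealVec p)
        - dSym N k p ν * B5Hk163Strip.h163 N μ lam k (ofRealVec p)‖ * ‖symmAlias N k p‖ ^ α
      ≤ (D163 d α γ + R163 d α γ) / (N : ℝ) ^ γ := by
  have hsplit : ∀ k : Fin d → Fin N,
      ‖dSym (R * N) (iota R k p) p ν * B5Hk163Strip.h163 (R * N) μ lam (iota R k p) (ofRealVec p)
          - dSym N k p ν * B5Hk163Strip.h163 N μ lam k (ofRealVec p)‖ * ‖symmAlias N k p‖ ^ α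
        ≤ (|symmAlias N k p ν| / N * |symmAlias N k p ν|) * maj163 d p (symmAlias N k p) μ lam
            * ‖symmAlias N k p‖ ^ α
          + ‖B5Hk163Strip.h163 N μ lam k (ofRealVec p)
              - B5Hk163Strip.h163 (R * N) μ lam (iota R k p) (ofRealVec p)‖
            * (|symmAlias N k p ν| * ‖symmAlias N k p‖ ^ α) := by
    intro k
    have h := mul_le_mul_of_nonneg_right (norm_dh_sub_dh_le hN hR p hp ν₀ hν₀ μ lam ν k)
      (Real.rpow_nonneg (norm_nonneg (symmAlias N k p)) α)
    refine h.trans (le_of_eq ?_)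
    ring
  have hw : ∀ k : Fin d → Fin N, 0 ≤ |symmAlias N k p ν| * ‖symmAlias N k p‖ ^ α
      ∧ |symmAlias N k p ν| * ‖symmAlias N k p‖ ^ α ≤ ‖symmAlias N k p‖ * ‖symmAlias N k p‖ ^ α := fun k =>
    ⟨mul_nonneg (abs_nonneg _) (Real.rpow_nonneg (norm_nonneg _) _),
      mul_le_mul_of_nonneg_right (abs_apply_le_norm _ ν) (Real.rpow_nonneg (norm_nonneg _) _)⟩
  calc _ ≤ ∑ k : Fin d → Fin N, ((|symmAlias N k p ν| / N * |symmAlias N k p ν|)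
              * maj163 d p (symmAlias N k p) μ lam * ‖symmAlias N k p‖ ^ α
            + ‖B5Hk163Strip.h163 N μ lam k (ofRealVec p)
                - B5Hk163Strip.h163 (R * N) μ lam (iota R k p) (ofRealVec p)‖
              * (|symmAlias N k p ν| * ‖symmAlias N k p‖ ^ α)) := Finset.sum_le_sum fun k _ => hsplit k
    _ = _ + _ := Finset.sum_add_distrib
    _ ≤ D163 d α γ / (N : ℝ) ^ γ + R163 d α γ / (N : ℝ) ^ γ :=
        add_le_add (sum_dsym_replacement_le hd hα0 hγ1 hαγ hN p hp ν₀ hν₀ μ lam ν)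
          (sum_h163_rate_le_of_weight hd hα0 hγ0 hγ1 hαγ hN hR p hp ν₀ hν₀ μ lam _ hw)
    _ = (D163 d α γ + R163 d α γ) / (N : ℝ) ^ γ := by rw [add_div]

/-! ## §7 the packaged η-rate of Bałaban's weighted (1.63) alias sum -/

/-- the total constant. [folklore] -/
def T163 (d : ℕ) (α γ : ℝ) : ℝ := D163 d α γ + R163 d α γ + U163 d α γ

/-- **(f) THE η-RATE OF THE WEIGHTED ALIAS SUM (symbol level, `U = 1`, finite torus)**: for `d ≥ 1`, `0 ≤ α`,
`0 < γ ≤ 1`, `α + γ < 1`, `N, R ≥ 1`, `p′ ∈ [−π,π]^d ∖ {0}` and directions `μ, λ, ν`, splitting the level-`RN` alias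
classes into the classes PAIRED with level `N` (`k″ = ι k`, same symmetric representative `q_k`) and the UNPAIRED ones
(`‖q″‖ ≥ πN`):
`Σ_k ‖∂^{(RN)}_ν(q_k) h^{(RN)}_{ιk}(p′) − ∂^{(N)}_ν(q_k) h^{(N)}_k(p′)‖·‖q_k‖^α`
`  + Σ_{k″ unpaired} ‖∂^{(RN)}_ν(q″) h^{(RN)}_{k″}(p′)‖·‖q″‖^α ≤ T163 d α γ · N^{−γ}` —
the vector-layer analogue of King's Fourier-side mechanism (4.22)–(4.25) for the last bound of (3.71), with the
currency `N^{−γ} = (η/η_coarse)^γ`; the position-space factors of (4.19) ((4.24), (4.26)–(4.28)) and the `∫dp′` are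
NOT part of this statement. [cite: King1986, (4.22)–(4.25) pp.672–673] [cite: Balaban1984PropagatorsI, p.28]
[folklore] -/
theorem weighted_alias_sum_rate (hd : 0 < d) {α γ : ℝ} (hα0 : 0 ≤ α) (hγ0 : 0 < γ) (hγ1 : γ ≤ 1)
    (hαγ : α + γ < 1) {N R : ℕ} [NeZero N] [NeZero R] (hN : 1 ≤ N) (hR : 1 ≤ R)
    (p : Fin d → ℝ) (hp : ∀ ν, |p ν| ≤ Real.pi) (ν₀ : Fin d) (hν₀ : p ν₀ ≠ 0) (μ lam ν : Fin d) :
    (∑ k : Fin d → Fin N, ‖dSym (R * N) (iota R k p) p ν * B5Hk163Strip.h163 (R * N) μ lam (iota R k p) (ofRealVec p)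
        - dSym N k p ν * B5Hk163Strip.h163 N μ lam k (ofRealVec p)‖ * ‖symmAlias N k p‖ ^ α)
      + ∑ k'' ∈ Finset.univ.filter (fun k'' => ∀ k : Fin d → Fin N, iota R k p ≠ k''),
          ‖dSym (R * N) k'' p ν * B5Hk163Strip.h163 (R * N) μ lam k'' (ofRealVec p)‖ * ‖symmAlias (R * N) k'' p‖ ^ α
      ≤ T163 d α γ / (N : ℝ) ^ γ := by
  have hU := sum_h163_unpaired_le hd hγ0.le hαγ hN hR p hp ν₀ hν₀ μ lam ν
  have hE := sum_dh163_rate_le hd hα0 hγ0 hγ1 hαγ hN hR p hp ν₀ hν₀ μ lam ν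
  have hU' : ∑ k'' ∈ Finset.univ.filter (fun k'' => ∀ k : Fin d → Fin N, iota R k p ≠ k''),
      ‖dSym (R * N) k'' p ν * B5Hk163Strip.h163 (R * N) μ lam k'' (ofRealVec p)‖ * ‖symmAlias (R * N) k'' p‖ ^ α
      ≤ U163 d α γ / (N : ℝ) ^ γ := by
    refine le_trans (le_of_eq (Finset.sum_congr rfl fun k'' _ => ?_)) hU
    unfold bwt; rw [norm_mul]; ring
  calc _ ≤ (D163 d α γ + R163 d α γ) / (N : ℝ) ^ γ + U163 d α γ / (N : ℝ) ^ γ := add_le_add hE hU'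
    _ = T163 d α γ / (N : ℝ) ^ γ := by unfold T163; rw [← add_div]

end Literature.MathematicalPhysics.QuantumFieldTheory.Balaban1983to89.B5Hk163RateSum

end
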